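import Mathlib.Tactic
import HarnessLib

/-!
# Kozma–Nitzan's Question 8 — UNI-C(U;y): the two-zone kernel of THEOREM DA′ (gen 40)

Support file (`--supports stmt-CriticalPhenomena-4575`, closed crux; independent mathematics on Kozma–Nitzan's Question 8,
arXiv:2401.12397 §5.5 p. 36), prover `prim-ineq-gen-6` (gen 40).  No definitions, no named facts, no sorries; standard axioms.
Memo `run/shared/lean/prim/prim-ineq-gen-6/PROOF-UNIC-LC-G40.md` §7 (THEOREM DA′).

THEOREM DA′ bounds the C-survival `C_[k₁,t] = (1−L₁)(1−L₂)` at a C-hypothesis node behind an A-death from ONE mixed budget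
inequality `A·L₁ + B·(1−L₁)·L₂ ≤ λ′` (connected zone: joint-death visibility `A = θ′σ_vα_v`; far zone: the mixed joint/kill
visibility `B = ν_min`).  The kernels:
* `kAD_two_zone` — `A·L₁ + B(1−L₁)L₂ ≤ λ′` with `L₁, L₂ ∈ [0,1]`, `A, B > 0` gives `(1−L₁)(1−L₂) ≥ 1 − λ′/min(A,B)`;
* `kAD_mix` — the budget mixing step `θ′J/B_J + (1−θ′)K/B_K ≤ 1` from `J ≤ B_J`, `K ≤ B_K`;
* `kAD_kill_linear` — the linear A-alive factor `A_v·ε̂_v ≥ p·(1 − ǔ_v)` behind `KW_v ≥ (1−ǔ_v)·C·α·Φ·BR₁`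
  (termwise: `A·(p·a') ≥ p·(1 − (1 − A·a'))` for a fragment with relative survival `a'` after `v` and `p ≥ p`).
Exact link checks: lab-g40/g40/l10_DAp.py (0 failures); box certificate lab-g40/g40/b03_boxDAp.py (σ₁ = 7/10, θ′ = 9/10,
489 841 cells, exact leaf verification).
[cite: KozmaNitzan2024, Question 8 (§5.5 p. 36)]
-/

namespace Summit.CriticalPhenomena.PercolationContinuityZ3.Theorems

namespace PocketCert

/-- **Two-zone lemma.**  If the connected-zone C-loss `L₁` and the far-zone C-loss `L₂` (`L₁ ∈ [0,1]`, `L₂ ≥ 0`) satisfy the mixed budget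
inequality `A·L₁ + B·(1−L₁)·L₂ ≤ λ′` with visibilities `A, B > 0`, then the total C-survival obeys
`(1−L₁)(1−L₂) ≥ 1 − λ′/min(A,B)`.
[cite: KozmaNitzan2024, Question 8 (§5.5 p. 36)] -/
theorem kAD_two_zone (A B L₁ L₂ lam : ℝ) (hA : 0 < A) (hB : 0 < B) (h10 : 0 ≤ L₁) (h11 : L₁ ≤ 1) (h20 : 0 ≤ L₂)
    (hbud : A * L₁ + B * (1 - L₁) * L₂ ≤ lam) :
    1 - lam / min A B ≤ (1 - L₁) * (1 - L₂) := by
  have hm : 0 < min A B := lt_min hA hB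
  have hmA : min A B ≤ A := min_le_left A B
  have hmB : min A B ≤ B := min_le_right A B
  -- (1−L₁)(1−L₂) = (1−L₁) − (1−L₁)L₂ and  min(A,B)·[L₁ + (1−L₁)L₂] ≤ A L₁ + B (1−L₁) L₂ ≤ λ′
  have h1 : min A B * L₁ ≤ A * L₁ := mul_le_mul_of_nonneg_right hmA h10
  have h2 : min A B * ((1 - L₁) * L₂) ≤ B * ((1 - L₁) * L₂) :=
    mul_le_mul_of_nonneg_right hmB (mul_nonneg (by linarith) h20)
  have h3 : min A B * (L₁ + (1 - L₁) * L₂) ≤ lam := by nlinarith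
  have h4 : L₁ + (1 - L₁) * L₂ ≤ lam / min A B := by
    rw [le_div_iff₀ hm]; nlinarith
  nlinarith

/-- **Budget mixing.**  From `J ≤ B_J`, `K ≤ B_K` with positive budgets and `θ ∈ [0,1]`:  `θ·J/B_J + (1−θ)·K/B_K ≤ 1`.
[cite: KozmaNitzan2024, Question 8 (§5.5 p. 36)] -/
theorem kAD_mix (J K BJ BK θ : ℝ) (hBJ : 0 < BJ) (hBK : 0 < BK) (hθ0 : 0 ≤ θ) (hθ1 : θ ≤ 1)
    (hJ : J ≤ BJ) (hK : K ≤ BK) : θ * (J / BJ) + (1 - θ) * (K / BK) ≤ 1 := by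
  have h1 : J / BJ ≤ 1 := by rw [div_le_one hBJ]; exact hJ
  have h2 : K / BK ≤ 1 := by rw [div_le_one hBK]; exact hK
  nlinarith [mul_le_mul_of_nonneg_left h1 hθ0, mul_le_mul_of_nonneg_left h2 (by linarith : (0:ℝ) ≤ 1 - θ)]

/-- **Linear A-alive factor, termwise.**  For a fragment after `v` with relative survival `a' ∈ [0,1]`, weight `p' ≥ p` and the
vertex mark `A ∈ [0,1]`:  `A·(p'·a') ≥ p·(1 − (1 − A·a'))`; summing over the fragments gives `A_v·ε̂_v ≥ p_{v−1}(1 − ǔ_v)`,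
so the kill weight carries the factor `(1 − ǔ_v)` once, not squared.
[cite: KozmaNitzan2024, Question 8 (§5.5 p. 36)] -/
theorem kAD_kill_linear (A a' p p' : ℝ) (hA0 : 0 ≤ A) (ha0 : 0 ≤ a') (hp : p ≤ p') :
    p * (1 - (1 - A * a')) ≤ A * (p' * a') := by
  have h1 : p * (A * a') ≤ p' * (A * a') := mul_le_mul_of_nonneg_right hp (mul_nonneg hA0 ha0)
  nlinarith

end PocketCert

end Summit.CriticalPhenomena.PercolationContinuityZ3.Theorems
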